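import Mathlib
import HarnessLib
import Summits.Ventures.LatticeQCDFlow.Scoring.BatchMeansCLT
import Summits.Ventures.LatticeQCDFlow.Scoring.BatchMeansTauInt
import Summits.Ventures.LatticeQCDFlow.Scoring.BatchMeansConsistencyEnvelope
import Summits.Ventures.LatticeQCDFlow.Scoring.ChainSampleVarianceRate
import Summits.Ventures.LatticeQCDFlow.Scoring.DoeblinPowerBatchMeansDeltaMethod

/-!
# THE CLT FOR THE BATCH-MEANS INTEGRATED AUTOCORRELATION TIME, FROM ANY START:
# `√a (τ̂_int − τ_int) ⇒ √2 τ_int · N(0, 1)` and `√a (τ̂_int − τ_int)/(√2 τ̂_int) ⇒ N(0, 1)`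

HONEST FRAMING: exact (Metropolis-corrected) sampling algorithms for lattice gauge theory;
figures of merit are autocorrelation/cost numbers at stated couplings and volumes; no
continuum-physics claim.

Venture `LatticeQCDFlow` (cell pub-lqcd), topic `Scoring`; FANOUT row 4 (`s0-u1-b`, GEN-30).
NEW WORK of the cell, not a published result; no definition is introduced; nothing is cited as a
fact.  The cell's figure of merit is `τ_int` per cost, reported by a run as `τ̂ = σ̂² / (2 v̂)` with
`σ̂² = ab · SE²_BM` the batch-means estimate of `σ²_f` and `v̂` the sample variance of the `N = ab`
measurements (`Scoring/BatchMeansTauInt.lean`: `τ̂ → τ_int = tauInt(γ/γ₀) = σ²_f/(2 Var_π f)` in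
probability).  THIS FILE IS ITS FLUCTUATION LAW under a geometric envelope, from any start, for
`a_n, b_n → ∞` with `a_n/b_n² → 0` and `Var_π f ≠ 0`:
`√a_n (τ̂_n − τ_int) ⇒ √2 τ_int · N(0, 1)` — THE RELATIVE STANDARD ERROR OF `τ̂_int` IS `√(2/a)`
(`a` = number of batches), the denominator `v̂` being deterministic at this scale
(`Scoring/ChainSampleVarianceRate.lean`: `√a (v̂ − Var_π f) → 0` in probability); and, for
`σ²_f > 0`, the studentisation `√a_n (τ̂_n − τ_int)/(√2 τ̂_n) ⇒ N(0, 1)`, i.e. the interval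
`τ̂ (1 ± z √(2/a))` is an asymptotically exact confidence interval for `τ_int`
(`Scoring/BatchMeansTauIntCoverage.lean`).  Route: the batch-means CLT
`√a (σ̂² − σ²_f) ⇒ N(0, 2σ⁴_f)` (`Scoring/BatchMeansCLT.lean`), two Slutsky steps with
`√a (v̂ − Var_π f) → 0` and `v̂ → Var_π f`, the algebra
`√a (τ̂ − τ) = [Var_π f · √a (σ̂² − σ²_f) − σ²_f · √a (v̂ − Var_π f)] / (2 Var_π f · v̂)`, and the
removal of a truncation of the denominator on an event of probability `→ 0` (the cell's pattern,
`Scoring/DoeblinPowerBatchMeansCLT.lean`).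

## Content

* **`chain_batchMeans_tauInt_clt_of_envelope`** — `Y ~ N(0, 1)`:
  `TendstoInDistribution (fun n x => √a_n (τ̂_n x − τ_int)) atTop (fun ω => √2 τ_int Y ω) (fun _ => P_{μ₀}) P'`;
* `chain_batchMeans_tauInt_tendstoInMeasure_of_envelope` — `τ̂_n → τ_int` in probability
  (envelope, any start, `a_n, b_n → ∞`);
* **`chain_batchMeans_tauInt_studentized_clt_of_envelope`** — `σ²_f > 0`, `Y ~ N(0, 1)`:
  `TendstoInDistribution (fun n x => √a_n (τ̂_n x − τ_int) / (√2 τ̂_n x)) atTop Y (fun _ => P_{μ₀}) P'`.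

NOT CLAIMED: `Var_π f = 0` or `σ²_f = 0`; the regime `a_n/b_n² ↛ 0`; the Γ-method's automatic
window; unbounded `f`.
-/

noncomputable section

namespace Summit.Ventures.LatticeQCDFlow.Scoring

open MeasureTheory ProbabilityTheory Filter Finset Preorder
open scoped ENNReal Topology

variable {Ω : Type*} [MeasurableSpace Ω]

variable {κ : Kernel Ω Ω} [IsMarkovKernel κ] {π : Measure Ω} [IsProbabilityMeasure π] {A ρ : ℝ}

/-- **THE `τ̂_int` CLT, FROM ANY START.**  Envelope `(A, ρ)`, `π` invariant, `|f| ≤ C` measurable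
with `γ₀ = Var_π f ≠ 0`; `a_n, b_n → ∞`, `a_n/b_n² → 0`; `τ̂_n = σ̂²_n/(2 v̂_n)`,
`τ_int = tauInt(γ/γ₀)`.  For `Y ~ N(0, 1)`: `√a_n (τ̂_n − τ_int) ⇒ √2 τ_int · Y`. -/
theorem chain_batchMeans_tauInt_clt_of_envelope (hπ : Kernel.Invariant κ π)
    (henv : ∀ (g : Ω → ℝ), Measurable g → ∀ (Cg : ℝ), (∀ x, |g x| ≤ Cg) →
      ∀ (t : ℕ) (x : Ω), |(kop κ)^[t] g x - ∫ y, g y ∂π| ≤ 2 * Cg * (A * ρ ^ t))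
    (hA : 0 ≤ A) (hρ0 : 0 ≤ ρ) (hρ1 : ρ < 1)
    {f : Ω → ℝ} (hf : Measurable f) {C : ℝ} (hC : ∀ x, |f x| ≤ C)
    (hvar : autocov κ π (fun y => f y - ∫ z, f z ∂π) 0 ≠ 0)
    (μ₀ : Measure Ω) [IsProbabilityMeasure μ₀] {a b : ℕ → ℕ} (ha : Tendsto a atTop atTop)
    (hb : Tendsto b atTop atTop) (hab : Tendsto (fun n => (a n : ℝ) / (b n : ℝ) ^ 2) atTop (𝓝 0))
    {Ω' : Type*} [MeasurableSpace Ω'] {P' : Measure Ω'} [IsProbabilityMeasure P'] {Y : Ω' → ℝ}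
    (hY : HasLaw Y (gaussianReal 0 1) P') [IsProbabilityMeasure (Kernel.trajMeasure (X := fun _ : ℕ
          => Ω) (μ₀)
          (fun n : ℕ => κ.comap (fun h' : (i : ↥(Finset.Iic n)) → Ω => h' ⟨n, Finset.mem_Iic.2
                le_rfl⟩)
            (measurable_pi_apply _)))] :
    TendstoInDistribution (fun (n : ℕ) (x : ℕ → Ω) =>
        Real.sqrt (a n) * ((((b n * a n : ℕ) : ℝ) * replicaSEsq (fun j (x : ℕ → Ω) => (∑ i ∈
              Finset.range (b n), f (x (b n * j + i))) / (b n)) (a n) x) / (2 * ((∑ t ∈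
              Finset.range (b n * a n), f (x t) ^ 2) / ((b n * a n : ℕ) : ℝ) - ((∑ t ∈ Finset.range
              (b n * a n), f (x t)) / ((b n * a n : ℕ) : ℝ)) ^ 2))
          - tauInt (fun t => autocov κ π (fun y => f y - ∫ z, f z ∂π) t
              / autocov κ π (fun y => f y - ∫ z, f z ∂π) 0)))
      atTop (fun ω => Real.sqrt 2 * tauInt (fun t => autocov κ π (fun y => f y - ∫ z, f z ∂π) t
              / autocov κ π (fun y => f y - ∫ z, f z ∂π) 0) * Y ω)
      (fun _ => (Kernel.trajMeasure (X := fun _ : ℕ => Ω) (μ₀)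
            (fun n : ℕ => κ.comap (fun h' : (i : ↥(Finset.Iic n)) → Ω => h' ⟨n, Finset.mem_Iic.2
                  le_rfl⟩)
              (measurable_pi_apply _)))) P' := by
  set P := (Kernel.trajMeasure (X := fun _ : ℕ => Ω) (μ₀)
        (fun n : ℕ => κ.comap (fun h' : (i : ↥(Finset.Iic n)) → Ω => h' ⟨n, Finset.mem_Iic.2
              le_rfl⟩)
          (measurable_pi_apply _))) with hP
  set γ : ℕ → ℝ := fun t => autocov κ π (fun y => f y - ∫ z, f z ∂π) t with hγ
  set v := ∫ z, (f z - ∫ z', f z' ∂π) ^ 2 ∂π with hv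
  set τ := tauInt (fun t => γ t / γ 0) with hτ
  set σ2 := (∫ y, (f y - ∫ z, f z ∂π) ^ 2 ∂π)
      + 2 * ∑' k, ∫ y, (f y - ∫ z, f z ∂π) * (kop κ)^[k + 1] (fun y => f y - ∫ z, f z ∂π) y ∂π
    with hσ2def
  -- `γ₀ = v > 0`, `σ² = 2 v τ`
  have hγ0 : γ 0 = v := autocov_zero κ π (fun y => f y - ∫ z, f z ∂π)
  have hvne : v ≠ 0 := by
    intro h0; apply hvar; show γ 0 = 0; rw [hγ0, h0]
  have hv0 : 0 < v := lt_of_le_of_ne (integral_nonneg fun _ => sq_nonneg _) (Ne.symm hvne)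
  have hσ2 : σ2 = 2 * v * τ := by
    rw [← hγ0, hσ2def, hτ, two_mul_mul_tauInt_eq hvar, autocov_zero]
    rfl
  have hτe : τ = σ2 / (2 * v) := by
    rw [hσ2]; field_simp
  -- measurability
  have hSigm : ∀ n, Measurable fun x : ℕ → Ω => (((b n * a n : ℕ) : ℝ) * replicaSEsq (fun j (x : ℕ
        → Ω) => (∑ i ∈ Finset.range (b n), f (x (b n * j + i))) / (b n)) (a n) x) := fun n =>
    measurable_batchMeans_sigmaHat hf (a n) (b n)
  have hf2 : Measurable fun z => f z ^ 2 := hf.pow_const 2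
  have hVm : ∀ n, Measurable fun x : ℕ → Ω => ((∑ t ∈ Finset.range (b n * a n), f (x t) ^ 2) / ((b
        n * a n : ℕ) : ℝ) - ((∑ t ∈ Finset.range (b n * a n), f (x t)) / ((b n * a n : ℕ) : ℝ)) ^
        2) := fun n =>
    ((Finset.measurable_sum _ fun t _ => hf2.comp (measurable_pi_apply _)).div_const _).sub
      (((Finset.measurable_sum _ fun t _ => hf.comp (measurable_pi_apply _)).div_const _).pow_const
            2)
  have hTm : ∀ n, Measurable fun x : ℕ → Ω => Real.sqrt (a n) * ((((b n * a n : ℕ) : ℝ) *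
        replicaSEsq (fun j (x : ℕ → Ω) => (∑ i ∈ Finset.range (b n), f (x (b n * j + i))) / (b n))
        (a n) x) / (2 * ((∑ t ∈ Finset.range (b n * a n), f (x t) ^ 2) / ((b n * a n : ℕ) : ℝ) -
        ((∑ t ∈ Finset.range (b n * a n), f (x t)) / ((b n * a n : ℕ) : ℝ)) ^ 2)) - τ) :=
    fun n => (((hSigm n).div ((hVm n).const_mul _)).sub_const _).const_mul _
  -- (1) the batch-means CLT with limit `√2 σ² · Y ~ N(0, 2σ⁴)`
  have hY₁ : HasLaw (fun ω => (Real.sqrt 2 * σ2) * Y ω) (gaussianReal 0 (Real.toNNReal (2 * σ2 ^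
        2))) P' := by
    refine ⟨hY.aemeasurable.const_mul _, ?_⟩
    rw [show (fun ω => (Real.sqrt 2 * σ2) * Y ω) = (fun t : ℝ => (Real.sqrt 2 * σ2) * t) ∘ Y from
          rfl,
      ← AEMeasurable.map_map_of_aemeasurable (measurable_const_mul _).aemeasurable hY.aemeasurable,
      hY.map_eq, gaussianReal_map_const_mul, mul_zero, mul_one]
    congr 1
    apply NNReal.coe_injective
    rw [NNReal.coe_mk, Real.coe_toNNReal _ (by positivity), mul_pow, Real.sq_sqrt (by norm_num)]
  have hclt := chain_batchMeans_sigmaHat_clt_of_envelope hπ henv hA hρ0 hρ1 hf hC μ₀ ha hb hab hY₁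
  -- (2) the denominator: `√a (v̂ − v) → 0`, `v̂ → v` in probability
  obtain ⟨hW2, hW1⟩ := chain_sqrt_mul_sampleVariance_sub_tendstoInMeasure_of_envelope (κ := κ) henv
        hA
    hρ0 hρ1 hf hC μ₀ ha hb
  rw [← hP, ← hv] at hW2 hW1
  -- (3) Slutsky 1: `(u, w) ↦ v u − σ² w`
  have hg1 : Continuous fun p : ℝ × ℝ => v * p.1 - σ2 * p.2 :=
    (continuous_const.mul continuous_fst).sub (continuous_const.mul continuous_snd)
  have hS1 := hclt.continuous_comp_prodMk_of_tendstoInMeasure_const hg1 hW2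
    (fun n => (((hVm n).sub_const _).const_mul _).aemeasurable)
  -- (4) Slutsky 2: `(u, w) ↦ u / (2 v · max(w, v/2))`
  have hg2 : Continuous fun p : ℝ × ℝ => p.1 / (2 * v * max p.2 (v / 2)) := by
    refine continuous_fst.div (continuous_const.mul (continuous_snd.max continuous_const)) fun p =>
          ?_
    exact (mul_pos (by positivity) (lt_max_of_lt_right (by positivity))).ne'
  have hS2 := hS1.continuous_comp_prodMk_of_tendstoInMeasure_const hg2 hW1 (fun n => (hVm
        n).aemeasurable)
  have hS2' := hS2.congr (fun n => EventuallyEq.rfl) (ae_of_all _ fun ω => (by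
    show (v * (Real.sqrt 2 * σ2 * Y ω) - σ2 * 0) / (2 * v * max v (v / 2)) = Real.sqrt 2 * τ * Y ω
    rw [max_eq_left (by linarith), hτe, mul_zero, sub_zero]
    field_simp))
  -- (5) the statistic `√a (τ̂ − τ)` agrees with the Slutsky statistic where `v̂ ≥ v/2`
  refine tendstoInDistribution_of_tendstoInMeasure_sub _ _ hS2' ?_ (fun n => (hTm n).aemeasurable)
  rw [tendstoInMeasure_iff_measureReal_norm]
  intro δ hδ
  have hW1' := (tendstoInMeasure_iff_measureReal_norm.1 hW1) (v / 2) (by positivity)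
  refine squeeze_zero' (Eventually.of_forall fun n => measureReal_nonneg)
    (Eventually.of_forall fun n => ?_) hW1'
  refine measureReal_mono fun x hx => ?_
  rw [Set.mem_setOf_eq]
  by_contra hcon
  rw [not_le, Real.norm_eq_abs, abs_lt] at hcon
  have hVpos : v / 2 < ((∑ t ∈ Finset.range (b n * a n), f (x t) ^ 2) / ((b n * a n : ℕ) : ℝ) - ((∑
        t ∈ Finset.range (b n * a n), f (x t)) / ((b n * a n : ℕ) : ℝ)) ^ 2) := by linarith [hcon.1]
  have hVne : ((∑ t ∈ Finset.range (b n * a n), f (x t) ^ 2) / ((b n * a n : ℕ) : ℝ) - ((∑ t ∈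
        Finset.range (b n * a n), f (x t)) / ((b n * a n : ℕ) : ℝ)) ^ 2) ≠ 0 := (lt_trans (by
        positivity) hVpos).ne'
  have hmax : max (((∑ t ∈ Finset.range (b n * a n), f (x t) ^ 2) / ((b n * a n : ℕ) : ℝ) - ((∑ t ∈
        Finset.range (b n * a n), f (x t)) / ((b n * a n : ℕ) : ℝ)) ^ 2)) (v / 2) = ((∑ t ∈
        Finset.range (b n * a n), f (x t) ^ 2) / ((b n * a n : ℕ) : ℝ) - ((∑ t ∈ Finset.range (b n
        * a n), f (x t)) / ((b n * a n : ℕ) : ℝ)) ^ 2) := max_eq_left hVpos.le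
  have key : ∀ S W r : ℝ, W ≠ 0 →
      r * (S / (2 * W) - τ) - (v * (r * (S - σ2)) - σ2 * (r * (W - v))) / (2 * v * W) = 0 := by
    intro S W r hW
    rw [hτe]
    field_simp
    ring
  change δ ≤ ‖(Real.sqrt (a n) * ((((b n * a n : ℕ) : ℝ) * replicaSEsq (fun j (x : ℕ → Ω) => (∑ i ∈
        Finset.range (b n), f (x (b n * j + i))) / (b n)) (a n) x) / (2 * ((∑ t ∈ Finset.range (b n
        * a n), f (x t) ^ 2) / ((b n * a n : ℕ) : ℝ) - ((∑ t ∈ Finset.range (b n * a n), f (x t)) /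
        ((b n * a n : ℕ) : ℝ)) ^ 2)) - τ)
      - (v * (Real.sqrt (a n) * ((((b n * a n : ℕ) : ℝ) * replicaSEsq (fun j (x : ℕ → Ω) => (∑ i ∈
            Finset.range (b n), f (x (b n * j + i))) / (b n)) (a n) x) - σ2)) - σ2 * (Real.sqrt (a
            n) * (((∑ t ∈ Finset.range (b n * a n), f (x t) ^ 2) / ((b n * a n : ℕ) : ℝ) - ((∑ t ∈
            Finset.range (b n * a n), f (x t)) / ((b n * a n : ℕ) : ℝ)) ^ 2) - v)))
        / (2 * v * max (((∑ t ∈ Finset.range (b n * a n), f (x t) ^ 2) / ((b n * a n : ℕ) : ℝ) -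
              ((∑ t ∈ Finset.range (b n * a n), f (x t)) / ((b n * a n : ℕ) : ℝ)) ^ 2)) (v / 2))) -
              0‖ at hx
  rw [sub_zero, hmax, key _ _ _ hVne, norm_zero] at hx
  exact absurd hx (not_le.2 hδ)

/-- **`τ̂_int → τ_int` in probability from any start, under the envelope** (`Var_π f ≠ 0`,
`a_n, b_n → ∞`; no condition on `a_n/b_n²`).  The minorised-kernel version with an almost-sure
denominator is `Scoring/BatchMeansTauInt.chain_batchMeans_tauInt_tendstoInMeasure`. -/
theorem chain_batchMeans_tauInt_tendstoInMeasure_of_envelope (hπ : Kernel.Invariant κ π)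
    (henv : ∀ (g : Ω → ℝ), Measurable g → ∀ (Cg : ℝ), (∀ x, |g x| ≤ Cg) →
      ∀ (t : ℕ) (x : Ω), |(kop κ)^[t] g x - ∫ y, g y ∂π| ≤ 2 * Cg * (A * ρ ^ t))
    (hA : 0 ≤ A) (hρ0 : 0 ≤ ρ) (hρ1 : ρ < 1)
    {f : Ω → ℝ} (hf : Measurable f) {C : ℝ} (hC : ∀ x, |f x| ≤ C)
    (hvar : autocov κ π (fun y => f y - ∫ z, f z ∂π) 0 ≠ 0)
    (μ₀ : Measure Ω) [IsProbabilityMeasure μ₀] {a b : ℕ → ℕ} (ha : Tendsto a atTop atTop)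
    (hb : Tendsto b atTop atTop) [IsProbabilityMeasure (Kernel.trajMeasure (X := fun _ : ℕ => Ω)
          (μ₀)
          (fun n : ℕ => κ.comap (fun h' : (i : ↥(Finset.Iic n)) → Ω => h' ⟨n, Finset.mem_Iic.2
                le_rfl⟩)
            (measurable_pi_apply _)))] :
    TendstoInMeasure (Kernel.trajMeasure (X := fun _ : ℕ => Ω) (μ₀)
          (fun n : ℕ => κ.comap (fun h' : (i : ↥(Finset.Iic n)) → Ω => h' ⟨n, Finset.mem_Iic.2
                le_rfl⟩)
            (measurable_pi_apply _))) (fun (n : ℕ) (x : ℕ → Ω) => (((b n * a n : ℕ) : ℝ) *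
                  replicaSEsq (fun j (x : ℕ → Ω) => (∑ i ∈ Finset.range (b n), f (x (b n * j + i)))
                  / (b n)) (a n) x) / (2 * ((∑ t ∈ Finset.range (b n * a n), f (x t) ^ 2) / ((b n *
                  a n : ℕ) : ℝ) - ((∑ t ∈ Finset.range (b n * a n), f (x t)) / ((b n * a n : ℕ) :
                  ℝ)) ^ 2))) atTop
      (fun _ => tauInt (fun t => autocov κ π (fun y => f y - ∫ z, f z ∂π) t
        / autocov κ π (fun y => f y - ∫ z, f z ∂π) 0)) := by
  set P := (Kernel.trajMeasure (X := fun _ : ℕ => Ω) (μ₀)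
        (fun n : ℕ => κ.comap (fun h' : (i : ↥(Finset.Iic n)) → Ω => h' ⟨n, Finset.mem_Iic.2
              le_rfl⟩)
          (measurable_pi_apply _))) with hP
  set γ : ℕ → ℝ := fun t => autocov κ π (fun y => f y - ∫ z, f z ∂π) t with hγ
  set v := ∫ z, (f z - ∫ z', f z' ∂π) ^ 2 ∂π with hv
  set σ2 := (∫ y, (f y - ∫ z, f z ∂π) ^ 2 ∂π)
      + 2 * ∑' k, ∫ y, (f y - ∫ z, f z ∂π) * (kop κ)^[k + 1] (fun y => f y - ∫ z, f z ∂π) y ∂π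
    with hσ2def
  have hγ0 : γ 0 = v := autocov_zero κ π (fun y => f y - ∫ z, f z ∂π)
  have hvne : v ≠ 0 := by
    intro h0; apply hvar; show γ 0 = 0; rw [hγ0, h0]
  have hσ2 : σ2 = 2 * γ 0 * tauInt (fun t => γ t / γ 0) := by
    rw [hσ2def, two_mul_mul_tauInt_eq hvar, autocov_zero]
    rfl
  have hτe : tauInt (fun t => γ t / γ 0) = σ2 / (2 * v) := by
    rw [hσ2, hγ0]; field_simp
  have hS := chain_batchMeans_sigmaHat_tendstoInMeasure_of_envelope hπ henv hA hρ0 hρ1 hf hC μ₀ ha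
        hb
  obtain ⟨-, hW1⟩ := chain_sqrt_mul_sampleVariance_sub_tendstoInMeasure_of_envelope (κ := κ) henv hA
    hρ0 hρ1 hf hC μ₀ ha hb
  rw [← hP, ← hσ2def] at hS
  rw [← hP, ← hv] at hW1
  have hψ : ContinuousAt (fun p : ℝ × ℝ => p.1 / (2 * p.2)) (σ2, v) :=
    (continuous_fst.continuousAt).div ((continuous_const.mul continuous_snd).continuousAt)
      (by simp only; positivity)
  have h := tendstoInMeasure_pair_comp hS hW1 hψ
  have hlim : σ2 / (2 * v) = tauInt (fun t => γ t / γ 0) := hτe.symm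
  rw [hlim] at h
  exact h

/-- **THE STUDENTISED `τ̂_int` CLT, FROM ANY START.**  As `chain_batchMeans_tauInt_clt_of_envelope`,
with moreover `σ²_f > 0`; for `Y ~ N(0, 1)`: `√a_n (τ̂_n − τ_int)/(√2 τ̂_n) ⇒ Y`. -/
theorem chain_batchMeans_tauInt_studentized_clt_of_envelope (hπ : Kernel.Invariant κ π)
    (henv : ∀ (g : Ω → ℝ), Measurable g → ∀ (Cg : ℝ), (∀ x, |g x| ≤ Cg) →
      ∀ (t : ℕ) (x : Ω), |(kop κ)^[t] g x - ∫ y, g y ∂π| ≤ 2 * Cg * (A * ρ ^ t))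
    (hA : 0 ≤ A) (hρ0 : 0 ≤ ρ) (hρ1 : ρ < 1)
    {f : Ω → ℝ} (hf : Measurable f) {C : ℝ} (hC : ∀ x, |f x| ≤ C)
    (hvar : autocov κ π (fun y => f y - ∫ z, f z ∂π) 0 ≠ 0)
    (hσ : 0 < (∫ y, (f y - ∫ z, f z ∂π) ^ 2 ∂π)
      + 2 * ∑' k, ∫ y, (f y - ∫ z, f z ∂π) * (kop κ)^[k + 1] (fun y => f y - ∫ z, f z ∂π) y ∂π)
    (μ₀ : Measure Ω) [IsProbabilityMeasure μ₀] {a b : ℕ → ℕ} (ha : Tendsto a atTop atTop)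
    (hb : Tendsto b atTop atTop) (hab : Tendsto (fun n => (a n : ℝ) / (b n : ℝ) ^ 2) atTop (𝓝 0))
    {Ω' : Type*} [MeasurableSpace Ω'] {P' : Measure Ω'} [IsProbabilityMeasure P'] {Y : Ω' → ℝ}
    (hY : HasLaw Y (gaussianReal 0 1) P') [IsProbabilityMeasure (Kernel.trajMeasure (X := fun _ : ℕ
          => Ω) (μ₀)
          (fun n : ℕ => κ.comap (fun h' : (i : ↥(Finset.Iic n)) → Ω => h' ⟨n, Finset.mem_Iic.2
                le_rfl⟩)
            (measurable_pi_apply _)))] :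
    TendstoInDistribution (fun (n : ℕ) (x : ℕ → Ω) =>
        Real.sqrt (a n) * ((((b n * a n : ℕ) : ℝ) * replicaSEsq (fun j (x : ℕ → Ω) => (∑ i ∈
              Finset.range (b n), f (x (b n * j + i))) / (b n)) (a n) x) / (2 * ((∑ t ∈
              Finset.range (b n * a n), f (x t) ^ 2) / ((b n * a n : ℕ) : ℝ) - ((∑ t ∈ Finset.range
              (b n * a n), f (x t)) / ((b n * a n : ℕ) : ℝ)) ^ 2))
          - tauInt (fun t => autocov κ π (fun y => f y - ∫ z, f z ∂π) t
              / autocov κ π (fun y => f y - ∫ z, f z ∂π) 0))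
        / (Real.sqrt 2 * ((((b n * a n : ℕ) : ℝ) * replicaSEsq (fun j (x : ℕ → Ω) => (∑ i ∈
              Finset.range (b n), f (x (b n * j + i))) / (b n)) (a n) x) / (2 * ((∑ t ∈
              Finset.range (b n * a n), f (x t) ^ 2) / ((b n * a n : ℕ) : ℝ) - ((∑ t ∈ Finset.range
              (b n * a n), f (x t)) / ((b n * a n : ℕ) : ℝ)) ^ 2)))))
      atTop Y (fun _ => (Kernel.trajMeasure (X := fun _ : ℕ => Ω) (μ₀)
            (fun n : ℕ => κ.comap (fun h' : (i : ↥(Finset.Iic n)) → Ω => h' ⟨n, Finset.mem_Iic.2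
                  le_rfl⟩)
              (measurable_pi_apply _)))) P' := by
  set P := (Kernel.trajMeasure (X := fun _ : ℕ => Ω) (μ₀)
        (fun n : ℕ => κ.comap (fun h' : (i : ↥(Finset.Iic n)) → Ω => h' ⟨n, Finset.mem_Iic.2
              le_rfl⟩)
          (measurable_pi_apply _))) with hP
  set γ : ℕ → ℝ := fun t => autocov κ π (fun y => f y - ∫ z, f z ∂π) t with hγ
  set v := ∫ z, (f z - ∫ z', f z' ∂π) ^ 2 ∂π with hv
  set τ := tauInt (fun t => γ t / γ 0) with hτ
  set σ2 := (∫ y, (f y - ∫ z, f z ∂π) ^ 2 ∂π)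
      + 2 * ∑' k, ∫ y, (f y - ∫ z, f z ∂π) * (kop κ)^[k + 1] (fun y => f y - ∫ z, f z ∂π) y ∂π
    with hσ2def
  have hγ0 : γ 0 = v := autocov_zero κ π (fun y => f y - ∫ z, f z ∂π)
  have hvne : v ≠ 0 := by
    intro h0; apply hvar; show γ 0 = 0; rw [hγ0, h0]
  have hv0 : 0 < v := lt_of_le_of_ne (integral_nonneg fun _ => sq_nonneg _) (Ne.symm hvne)
  have hσ2 : σ2 = 2 * v * τ := by
    rw [← hγ0, hσ2def, hτ, two_mul_mul_tauInt_eq hvar, autocov_zero]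
    rfl
  have hτe : τ = σ2 / (2 * v) := by
    rw [hσ2]; field_simp
  have hτ0 : 0 < τ := by rw [hτe]; positivity
  have h2 : (0 : ℝ) < Real.sqrt 2 := Real.sqrt_pos.2 (by norm_num)
  -- measurability
  have hSigm : ∀ n, Measurable fun x : ℕ → Ω => (((b n * a n : ℕ) : ℝ) * replicaSEsq (fun j (x : ℕ
        → Ω) => (∑ i ∈ Finset.range (b n), f (x (b n * j + i))) / (b n)) (a n) x) := fun n =>
    measurable_batchMeans_sigmaHat hf (a n) (b n)
  have hf2 : Measurable fun z => f z ^ 2 := hf.pow_const 2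
  have hVm : ∀ n, Measurable fun x : ℕ → Ω => ((∑ t ∈ Finset.range (b n * a n), f (x t) ^ 2) / ((b
        n * a n : ℕ) : ℝ) - ((∑ t ∈ Finset.range (b n * a n), f (x t)) / ((b n * a n : ℕ) : ℝ)) ^
        2) := fun n =>
    ((Finset.measurable_sum _ fun t _ => hf2.comp (measurable_pi_apply _)).div_const _).sub
      (((Finset.measurable_sum _ fun t _ => hf.comp (measurable_pi_apply _)).div_const _).pow_const
            2)
  have hτm : ∀ n, Measurable fun x : ℕ → Ω => (((b n * a n : ℕ) : ℝ) * replicaSEsq (fun j (x : ℕ →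
        Ω) => (∑ i ∈ Finset.range (b n), f (x (b n * j + i))) / (b n)) (a n) x) / (2 * ((∑ t ∈
        Finset.range (b n * a n), f (x t) ^ 2) / ((b n * a n : ℕ) : ℝ) - ((∑ t ∈ Finset.range (b n
        * a n), f (x t)) / ((b n * a n : ℕ) : ℝ)) ^ 2)) :=
    fun n => (hSigm n).div ((hVm n).const_mul _)
  have hTm : ∀ n, Measurable fun x : ℕ → Ω => Real.sqrt (a n) * ((((b n * a n : ℕ) : ℝ) *
        replicaSEsq (fun j (x : ℕ → Ω) => (∑ i ∈ Finset.range (b n), f (x (b n * j + i))) / (b n))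
        (a n) x) / (2 * ((∑ t ∈ Finset.range (b n * a n), f (x t) ^ 2) / ((b n * a n : ℕ) : ℝ) -
        ((∑ t ∈ Finset.range (b n * a n), f (x t)) / ((b n * a n : ℕ) : ℝ)) ^ 2)) - τ)
      / (Real.sqrt 2 * ((((b n * a n : ℕ) : ℝ) * replicaSEsq (fun j (x : ℕ → Ω) => (∑ i ∈
            Finset.range (b n), f (x (b n * j + i))) / (b n)) (a n) x) / (2 * ((∑ t ∈ Finset.range
            (b n * a n), f (x t) ^ 2) / ((b n * a n : ℕ) : ℝ) - ((∑ t ∈ Finset.range (b n * a n), f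
            (x t)) / ((b n * a n : ℕ) : ℝ)) ^ 2)))) :=
    fun n => (((hτm n).sub_const _).const_mul _).div ((hτm n).const_mul _)
  -- (1) the `τ̂` CLT
  have hclt := chain_batchMeans_tauInt_clt_of_envelope hπ henv hA hρ0 hρ1 hf hC hvar μ₀ ha hb hab hY
  -- (2) `τ̂ → τ` in probability
  have hτh := chain_batchMeans_tauInt_tendstoInMeasure_of_envelope hπ henv hA hρ0 hρ1 hf hC hvar μ₀
    ha hb
  rw [← hP] at hτh
  replace hτh : TendstoInMeasure P (fun (n : ℕ) (x : ℕ → Ω) => (((b n * a n : ℕ) : ℝ) * replicaSEsq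
        (fun j (x : ℕ → Ω) => (∑ i ∈ Finset.range (b n), f (x (b n * j + i))) / (b n)) (a n) x) /
        (2 * ((∑ t ∈ Finset.range (b n * a n), f (x t) ^ 2) / ((b n * a n : ℕ) : ℝ) - ((∑ t ∈
        Finset.range (b n * a n), f (x t)) / ((b n * a n : ℕ) : ℝ)) ^ 2))) atTop
      (fun _ => τ) := hτh
  -- (3) Slutsky: `(u, w) ↦ u / (√2 · max(w, τ/4))`
  have hgc : Continuous fun p : ℝ × ℝ => p.1 / (Real.sqrt 2 * max p.2 (τ / 4)) := by
    refine continuous_fst.div (continuous_const.mul (continuous_snd.max continuous_const)) fun p =>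
          ?_
    exact (mul_pos h2 (lt_max_of_lt_right (by positivity))).ne'
  have hU := hclt.continuous_comp_prodMk_of_tendstoInMeasure_const hgc hτh (fun n => (hτm
        n).aemeasurable)
  have hU' := hU.congr (fun n => EventuallyEq.rfl) (ae_of_all _ fun ω => (by
    show Real.sqrt 2 * τ * Y ω / (Real.sqrt 2 * max τ (τ / 4)) = Y ω
    rw [max_eq_left (by linarith)]
    field_simp))
  -- (4) remove the truncation: the statistics agree where `τ̂ ≥ τ/4`
  refine tendstoInDistribution_of_tendstoInMeasure_sub _ Y hU' ?_ (fun n => (hTm n).aemeasurable)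
  rw [tendstoInMeasure_iff_measureReal_norm]
  intro δ hδ
  have hτh' := (tendstoInMeasure_iff_measureReal_norm.1 hτh) (3 * τ / 4) (by positivity)
  refine squeeze_zero' (Eventually.of_forall fun n => measureReal_nonneg)
    (Eventually.of_forall fun n => ?_) hτh'
  refine measureReal_mono fun x hx => ?_
  rw [Set.mem_setOf_eq]
  by_contra hcon
  rw [not_le, Real.norm_eq_abs, abs_lt] at hcon
  have hmax : max ((((b n * a n : ℕ) : ℝ) * replicaSEsq (fun j (x : ℕ → Ω) => (∑ i ∈ Finset.range
        (b n), f (x (b n * j + i))) / (b n)) (a n) x) / (2 * ((∑ t ∈ Finset.range (b n * a n), f (x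
        t) ^ 2) / ((b n * a n : ℕ) : ℝ) - ((∑ t ∈ Finset.range (b n * a n), f (x t)) / ((b n * a n
        : ℕ) : ℝ)) ^ 2))) (τ / 4) = (((b n * a n : ℕ) : ℝ) * replicaSEsq (fun j (x : ℕ → Ω) => (∑ i
        ∈ Finset.range (b n), f (x (b n * j + i))) / (b n)) (a n) x) / (2 * ((∑ t ∈ Finset.range (b
        n * a n), f (x t) ^ 2) / ((b n * a n : ℕ) : ℝ) - ((∑ t ∈ Finset.range (b n * a n), f (x t))
        / ((b n * a n : ℕ) : ℝ)) ^ 2)) :=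
    max_eq_left (by linarith [hcon.1])
  change δ ≤ ‖(Real.sqrt (a n) * ((((b n * a n : ℕ) : ℝ) * replicaSEsq (fun j (x : ℕ → Ω) => (∑ i ∈
        Finset.range (b n), f (x (b n * j + i))) / (b n)) (a n) x) / (2 * ((∑ t ∈ Finset.range (b n
        * a n), f (x t) ^ 2) / ((b n * a n : ℕ) : ℝ) - ((∑ t ∈ Finset.range (b n * a n), f (x t)) /
        ((b n * a n : ℕ) : ℝ)) ^ 2)) - τ) / (Real.sqrt 2 * ((((b n * a n : ℕ) : ℝ) * replicaSEsq
        (fun j (x : ℕ → Ω) => (∑ i ∈ Finset.range (b n), f (x (b n * j + i))) / (b n)) (a n) x) /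
        (2 * ((∑ t ∈ Finset.range (b n * a n), f (x t) ^ 2) / ((b n * a n : ℕ) : ℝ) - ((∑ t ∈
        Finset.range (b n * a n), f (x t)) / ((b n * a n : ℕ) : ℝ)) ^ 2))))
      - Real.sqrt (a n) * ((((b n * a n : ℕ) : ℝ) * replicaSEsq (fun j (x : ℕ → Ω) => (∑ i ∈
            Finset.range (b n), f (x (b n * j + i))) / (b n)) (a n) x) / (2 * ((∑ t ∈ Finset.range
            (b n * a n), f (x t) ^ 2) / ((b n * a n : ℕ) : ℝ) - ((∑ t ∈ Finset.range (b n * a n), f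
            (x t)) / ((b n * a n : ℕ) : ℝ)) ^ 2)) - τ)
        / (Real.sqrt 2 * max ((((b n * a n : ℕ) : ℝ) * replicaSEsq (fun j (x : ℕ → Ω) => (∑ i ∈
              Finset.range (b n), f (x (b n * j + i))) / (b n)) (a n) x) / (2 * ((∑ t ∈
              Finset.range (b n * a n), f (x t) ^ 2) / ((b n * a n : ℕ) : ℝ) - ((∑ t ∈ Finset.range
              (b n * a n), f (x t)) / ((b n * a n : ℕ) : ℝ)) ^ 2))) (τ / 4))) - 0‖ at hx
  rw [sub_zero, hmax, sub_self, norm_zero] at hx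
  exact absurd hx (not_le.2 hδ)

end Summit.Ventures.LatticeQCDFlow.Scoring

end
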